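import Summits.ValiantsHypothesis.ValiantsHypothesis.Theorems.NewtonUnitEquationsTwoProductsMomentRecordDefs
import Summits.ValiantsHypothesis.ValiantsHypothesis.Theorems.NewtonUnitEquationsTwoProductsMomentRecordRungDefs

/-!
# val-idea-37 (g4) — RECORD LETTERS ARE FREE: the letter count of W3's `MomentRecordLaw` (A) is a dimension count
# rev 4: THE LANDED (A) `MomentRecordLaw` AND THE LANDED RUNG STATEMENT (A∘) `MomentRecordLawUsed` ARE PROVED HERE (scratch; 0 sorry)

rev 4 (22:3xZ): §4 `Count` added and the file now imports the landed `…MomentRecordRungDefs` (22:21Z): `momentRecordLaw_holds :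
MomentRecordLaw` (THE LANDED (A), ✓Defs p670581; its `TermSparse`/`CarrierDissociated` hypotheses unused) and `momentRecordLawUsed_holds :
MomentRecordLawUsed` (crit-8's rung statement of record (A∘), landed RungDefs) with `(a, b) = (17, 2)`, via `momentRecordCount`:
#records over weights negative on the used base letters `≤ 32 (n²+1) (m+1)² 2^{5m}` (cells of the REAL weight plane × stars-and-bars), from
rev 3's `weakRecordLemmaUsed_holds` (K2 with CONSTANT coefficients, no orientation split) and rev 1's `card_le_finrank_of_greedy` (K1 = dim ℂ^{4m}).
Audit at the end: `example`s inhabiting the three landed Props by their fully-qualified tree names; `#print axioms`.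
rev 2/3: `weakRecordLemma_holds`, `weakRecordLemmaUsed_holds`, `recordLetterBound(Used)_holds` PROVED.
Scratch evidence for crux `stmt-ValiantsHypothesis-5906` (`TwoProducts`), refining my g3 card `dvr-collapse-records`
(and bearing on val-idea-34 g5 `pencil-record-bound` K1, val-idea-35 g3 `RKRecordLemma.GreedyLengthBound`).
VP ≠ VNP is NOT proved; crux 5906 and the CLASS rung (B) `ShiftedCarrierLaw` stay OPEN (the (A∘) ⇒ (B) transport `shiftedCarrier_of_lawUsed` is
val-lit-p3 g17's typed target); (A)/(A∘) are proved only in THIS SCRATCH FILE until a prover lands it under Theorems/; nothing here is a tree write or a claim.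

## The observation (paper, 10 lines; toy-checked exactly on 30 589 strict records, 0 violations)
Let `γ_{j a} = α_{j a} + z β_{j a}` be the letter pencils (`j` over the `2m` signed terms, `a` over carriers) and
`G(T) = Σ_j ε_j Π_a γ_{j a}^{T_a}`, so W3's `layer k T = [z^k] G(T)`.  If for one carrier `a` the PENCIL VECTOR
`(γ_{j a})_j ∈ ℂ[z]^{2m}_{≤ 1} ≅ ℂ^{4m}` is a ℂ-LINEAR combination `γ_{·a} = μ·𝟙 + Σ_{b ∈ C} ν_b γ_{·b}` (constants `μ, ν_b ∈ ℂ`),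
then for every `T` with `T_a ≥ 1`:  `G(T) = μ G(T − e_a) + Σ_b ν_b G(T − e_a + e_b)` in `ℂ[z]`, hence — SAME layer `k`, because the
coefficients are constants — `layer k T = μ · layer k (T − e_a) + Σ_b ν_b · layer k (T − e_a + e_b)`.
Now let `(S, k)` be a RECORD for `ξ` (W3 `IsRecord`: live and strictly `ξ`-heavier than every other live shallow pair) and let
`C = {b ≠ a : wt ξ (x a) ≤ wt ξ (x b)}` (carriers at most as costly as `a`).  The pairs `(S − e_a, k)` and `(S − e_a + e_b, k)` are shallow,
different from `(S, k)`, and NOT lighter: `wtZ (ptZ (S − e_a) k) = wtZ (ptZ S k) − wt ξ (x a) > wtZ (ptZ S k)` (carriers have negative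
weight) and `wtZ (ptZ (S − e_a + e_b) k) = wtZ (ptZ S k) − wt ξ (x a) + wt ξ (x b) ≥ wtZ (ptZ S k)`.  So they are dead, and the displayed
identity gives `layer k S = 0`, contradicting liveness.  HENCE (weak record lemma, `WeakRecordLemma` below):
  **every carrier of a record multiset has its pencil vector OUTSIDE the ℂ-span of `𝟙` and the pencil vectors of the carriers at most as costly.**
No sign condition on `ξ·d`, no picture reversal, no localisation `ℂ[z]_{(z)}`, no truncation `ℂ[z]/z^{K+1}`, and ALL layers `k` at once.
CONSEQUENCE (a dimension count, `card_add_le_finrank_of_greedy` below, PROVED): along the cost order each record letter raises the dimension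
of `span{𝟙, pencil vectors so far}` inside the `4m`-dimensional pencil space, so **at most `4m − 1` record letters per carrier preorder** —
uniformly in `k`, `n`, `t` and the truncation depth.  This replaces: my g3 K1 (modular law + length additivity + determinant degree, «M/L in Lean»),
val-idea-34 g5 K1 (Γ = Ψ + deg V via Forney indices / Plücker, «≈ 400 lines»), val-idea-35 g3 (d) `GreedyLengthBound ≤ (N−1)(K+1)` (K-dependent).
With the arcs count (≤ `2(C(n,2)+1)` sectors + as many rays of the arrangement `ξ·(x_a − x_b) = 0`, `ξ·d = 0`; on each, `k` is determined by `S`: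
min live layer if `ξ·d < 0`… i.e. cost of `d` positive, max if negative, unique live layer if zero) this gives
`#records ≤ 4(C(n,2)+1)·C(5m−1, m) ≤ (2n²+4)·2^{5m−1} ≤ 2^{9m}(t+2)^2` under `n ≤ 2mt`: W3 (A) with `(a,b) = (9,2)`.
MULTI-OFFSET EXTENSION (same proof, pencil space of dimension `2m(r+1)`): alphabets `x_a + D`, `D = {0, d_1, …, d_r}` independent shifts
(pencils affine-linear in `z_1..z_r`) OR `D = {0, w_1 d, …, w_r d}` towers along one direction (pencils `Σ_l c_l s^{w_l}`): record letters per
carrier preorder `≤ 2m(r+1) − 1`.  Typed in the companion file `Sketch-g4-multishift.lean`.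
-/

set_option linter.unusedVariables false
set_option linter.unusedSectionVars false

noncomputable section

open Classical

namespace ValIdea37g4

open scoped BigOperators
open Module Submodule
open Summit.ValiantsHypothesis.ValiantsHypothesis.Theorems.NewtonUnitEquations.TwoProducts.FormalLogLinearisation
open Summit.ValiantsHypothesis.ValiantsHypothesis.Theorems.NewtonUnitEquations.TwoProducts.MomentRecord

/-! ## 1. The abstract greedy-record count (PROVED) -/

/-- **Greedy records are few.**  In a finite-dimensional space `W`, let `f : ι → W`, a distinguished vector `w₀`, a cost `key : ι → α`
into a linear order, and a finite set `Rec` such that every `a ∈ Rec` has `f a` outside the span of `w₀` and of the `f b` with `b ≠ a`,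
`key b ≤ key a`.  Then `#Rec + [w₀ ≠ 0] ≤ finrank W`. -/
theorem card_add_le_finrank_of_greedy {k W ι α : Type*} [DivisionRing k] [AddCommGroup W] [Module k W]
    [FiniteDimensional k W] [LinearOrder α] (key : ι → α) (f : ι → W) (w₀ : W) (Rec : Finset ι)
    (h : ∀ a ∈ Rec, f a ∉ span k (insert w₀ (f '' {b : ι | b ≠ a ∧ key b ≤ key a}))) :
    Rec.card + (if w₀ = 0 then 0 else 1) ≤ finrank k W := by
  classical
  -- motive: for `s ⊆ Rec`, `#s + [w₀ ≠ 0] ≤ finrank (span (insert w₀ (f '' s)))`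
  suffices H : ∀ s : Finset ι, s ⊆ Rec →
      s.card + (if w₀ = 0 then 0 else 1) ≤ finrank k (span k (insert w₀ (f '' (s : Set ι)))) by
    exact (H Rec le_rfl).trans (Submodule.finrank_le _)
  intro s
  induction s using Finset.induction_on_max_value key with
  | empty =>
    intro _
    by_cases hw : w₀ = 0
    · simp [hw]
    · have hins : (insert w₀ (f '' ((∅ : Finset ι) : Set ι))) = ({w₀} : Set W) := by
        rw [Finset.coe_empty, Set.image_empty, ← Set.singleton_def]
      rw [hins, finrank_span_singleton hw]
      simp [hw]
  | insert a s ha hkey ih =>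
    intro hsub
    have haRec : a ∈ Rec := hsub (Finset.mem_insert_self a s)
    have hsRec : s ⊆ Rec := fun x hx => hsub (Finset.mem_insert_of_mem hx)
    have ih' := ih hsRec
    -- `f a` is outside the smaller span
    set T : Submodule k W := span k (insert w₀ (f '' (s : Set ι))) with hT
    set T' : Submodule k W := span k (insert w₀ (f '' ((insert a s : Finset ι) : Set ι))) with hT'
    have hsubset : (f '' (s : Set ι)) ⊆ f '' {b : ι | b ≠ a ∧ key b ≤ key a} := by
      apply Set.image_mono
      intro x hx
      refine ⟨?_, hkey x hx⟩
      rintro rfl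
      exact ha hx
    have hfa : f a ∉ T := by
      intro hmem
      apply h a haRec
      exact Submodule.span_mono (Set.insert_subset_insert hsubset) hmem
    have hle : T ≤ T' := by
      apply Submodule.span_mono
      apply Set.insert_subset_insert
      apply Set.image_mono
      intro x hx
      simp only [Finset.coe_insert, Set.mem_insert_iff]
      exact Or.inr hx
    have hfa' : f a ∈ T' := by
      apply Submodule.subset_span
      apply Set.mem_insert_of_mem
      exact ⟨a, by simp, rfl⟩
    have hlt : T < T' := lt_of_le_of_ne hle (fun hEq => hfa (hEq ▸ hfa'))
    have hrank : finrank k T < finrank k T' := Submodule.finrank_lt_finrank_of_lt hlt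
    have hcard : (insert a s).card = s.card + 1 := Finset.card_insert_of_notMem ha
    rw [hcard]
    omega

/-- Corollary without the distinguished vector. -/
theorem card_le_finrank_of_greedy {k W ι α : Type*} [DivisionRing k] [AddCommGroup W] [Module k W]
    [FiniteDimensional k W] [LinearOrder α] (key : ι → α) (f : ι → W) (w₀ : W) (Rec : Finset ι)
    (h : ∀ a ∈ Rec, f a ∉ span k (insert w₀ (f '' {b : ι | b ≠ a ∧ key b ≤ key a}))) :
    Rec.card ≤ finrank k W :=
  le_trans (Nat.le_add_right _ _) (card_add_le_finrank_of_greedy key f w₀ Rec h)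

/-! ## 2. The weak record lemma, typed over the LANDED W3 vocabulary (`…TwoProducts.MomentRecord`, ✓ `MomentRecordDefs`) -/

variable {m n : ℕ}

/-- The PENCIL VECTOR of carrier `a`: for each signed term (`Sum.inl j` = side `u`, `Sum.inr j` = side `v`) the pair
`(coefficient of X^{x a}, coefficient of X^{x a + d}) = (α j a, β j a)`.  The pencil space `(Fin m ⊕ Fin m) → Fin 2 → ℂ` has dimension `4m`. -/
def pencilVec (α β α' β' : Fin m → Fin n → ℂ) (a : Fin n) : (Fin m ⊕ Fin m) → Fin 2 → ℂ :=
  Sum.elim (fun j => ![α j a, β j a]) (fun j => ![α' j a, β' j a])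

/-- The constant vector `𝟙` (the `1` of `log (1 + u_j)`), as a pencil vector. -/
def oneVec (m : ℕ) : (Fin m ⊕ Fin m) → Fin 2 → ℂ := fun _ => ![1, 0]

/-- The cost of carrier `a` for the weight `ξ` (positive when the carrier has negative weight). -/
def cost (ξ : Fin 2 → ℝ) (x : Fin n → Expo) (a : Fin n) : ℝ := - wt ξ (x a)

/-- **WEAK RECORD LEMMA** (sign-free, layer-free; paper proof in the header; PROVED below, `weakRecordLemma_holds`):
for every weight negative on the carriers and every W3-record `(S, k)` (any shallowness bound `m'`, any shift `d ∈ ℤ²`), every carrier `a`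
of `S` has its pencil vector outside the ℂ-span of `𝟙` and of the pencil vectors of the other carriers of cost `≤ cost a`. -/
def WeakRecordLemma : Prop :=
  ∀ (m n m' : ℕ) (α β α' β' : Fin m → Fin n → ℂ) (x : Fin n → Expo) (d : Fin 2 → ℤ) (ξ : Fin 2 → ℝ)
    (S : Fin n → ℕ) (k : ℕ),
    (∀ i, wt ξ (x i) < 0) → IsRecord α β α' β' x d m' ξ (S, k) →
    ∀ a : Fin n, 0 < S a →
      pencilVec α β α' β' a ∉
        Submodule.span ℂ (insert (oneVec m) (pencilVec α β α' β' '' {b : Fin n | b ≠ a ∧ cost ξ x b ≤ cost ξ x a}))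

/-- **WEAK RECORD LEMMA, used-letter form** (feeds crit-8's rung of record (A∘) `MomentRecordLawUsed`, W4 rev 2/3, whose weights are
negative only on letters that OCCUR — `NegWeightUsed`'s first clause is exactly the hypothesis here): same conclusion.  PROVED below
(`weakRecordLemmaUsed_holds`); NO orientation case `cost(d) ≥ 0 / ≤ 0` is needed (contrast W4 `RecordCarrierLocal`). -/
def WeakRecordLemmaUsed : Prop :=
  ∀ (m n m' : ℕ) (α β α' β' : Fin m → Fin n → ℂ) (x : Fin n → Expo) (d : Fin 2 → ℤ) (ξ : Fin 2 → ℝ)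
    (S : Fin n → ℕ) (k : ℕ),
    (∀ i, ((∃ j, α j i ≠ 0) ∨ ∃ j, α' j i ≠ 0) → wt ξ (x i) < 0) → IsRecord α β α' β' x d m' ξ (S, k) →
    ∀ a : Fin n, 0 < S a →
      pencilVec α β α' β' a ∉
        Submodule.span ℂ (insert (oneVec m) (pencilVec α β α' β' '' {b : Fin n | b ≠ a ∧ cost ξ x b ≤ cost ξ x a}))

theorem weakRecordLemma_of_used (h : WeakRecordLemmaUsed) : WeakRecordLemma := by
  intro m n m' α β α' β' x d ξ S k hneg hrec a hSa
  exact h m n m' α β α' β' x d ξ S k (fun i _ => hneg i) hrec a hSa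

/-- The RECORD LETTERS of a weight: carriers occurring in some record multiset. -/
def recordLetters (α β α' β' : Fin m → Fin n → ℂ) (x : Fin n → Expo) (d : Fin 2 → ℤ) (m' : ℕ) (ξ : Fin 2 → ℝ) :
    Finset (Fin n) :=
  Finset.univ.filter fun a => ∃ (S : Fin n → ℕ) (k : ℕ), IsRecord α β α' β' x d m' ξ (S, k) ∧ 0 < S a

/-- **RECORD LETTER BOUND** (the former «K1», now a dimension count): at most `4m` record letters per weight
(paper: `4m − 1`; the same set for every weight in a cell of the arrangement `ξ·(x_a − x_b) = 0`), uniformly in `k`, `n`, `t`, `m'`. -/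
def RecordLetterBound : Prop :=
  ∀ (m n m' : ℕ) (α β α' β' : Fin m → Fin n → ℂ) (x : Fin n → Expo) (d : Fin 2 → ℤ) (ξ : Fin 2 → ℝ),
    (∀ i, wt ξ (x i) < 0) → (recordLetters α β α' β' x d m' ξ).card ≤ 4 * m

theorem finrank_pencilSpace (m : ℕ) : finrank ℂ ((Fin m ⊕ Fin m) → Fin 2 → ℂ) = 4 * m := by
  rw [Module.finrank_pi_fintype]
  simp only [Module.finrank_pi, Fintype.card_fin, Finset.sum_const, Finset.card_univ, Fintype.card_sum,
    smul_eq_mul]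
  ring

/-- `WeakRecordLemma → RecordLetterBound` — kernel-checked via `card_le_finrank_of_greedy`. -/
theorem recordLetterBound_of_weak (hW : WeakRecordLemma) : RecordLetterBound := by
  intro m n m' α β α' β' x d ξ hneg
  have h := card_le_finrank_of_greedy (k := ℂ) (cost ξ x) (pencilVec α β α' β') (oneVec m)
    (recordLetters α β α' β' x d m' ξ) ?_
  · simpa [finrank_pencilSpace] using h
  · intro a ha
    simp only [recordLetters, Finset.mem_filter, Finset.mem_univ, true_and] at ha
    obtain ⟨S, k, hrec, hSa⟩ := ha
    exact hW m n m' α β α' β' x d ξ S k hneg hrec a hSa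

/-- Used-letter form of the record letter bound (for (A∘)). -/
def RecordLetterBoundUsed : Prop :=
  ∀ (m n m' : ℕ) (α β α' β' : Fin m → Fin n → ℂ) (x : Fin n → Expo) (d : Fin 2 → ℤ) (ξ : Fin 2 → ℝ),
    (∀ i, ((∃ j, α j i ≠ 0) ∨ ∃ j, α' j i ≠ 0) → wt ξ (x i) < 0) →
    (recordLetters α β α' β' x d m' ξ).card ≤ 4 * m

theorem recordLetterBoundUsed_of_weak (hW : WeakRecordLemmaUsed) : RecordLetterBoundUsed := by
  intro m n m' α β α' β' x d ξ hneg
  have h := card_le_finrank_of_greedy (k := ℂ) (cost ξ x) (pencilVec α β α' β') (oneVec m)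
    (recordLetters α β α' β' x d m' ξ) ?_
  · simpa [finrank_pencilSpace] using h
  · intro a ha
    simp only [recordLetters, Finset.mem_filter, Finset.mem_univ, true_and] at ha
    obtain ⟨S, k, hrec, hSa⟩ := ha
    exact hW m n m' α β α' β' x d ξ S k hneg hrec a hSa

/-! ## 3. The count this yields for (A) (typed; arcs enumeration = PlanarCell-file routine, S/M) -/

/-- Explicit form of W3 (A): records `≤ 4·(C(n,2)+1)·C(5m−1, m)` (cells of the weight arrangement × multisets of size `≤ m` on `≤ 4m−1`
record letters; `k` is determined by `S` on each cell).  Typed target. -/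
def MomentRecordCountG4 : Prop :=
  ∀ (m n t : ℕ) (α β α' β' : Fin m → Fin n → ℂ) (x : Fin n → Expo) (d : Fin 2 → ℤ),
    2 ≤ t → TermSparse α β t → TermSparse α' β' t → n ≤ 2 * m * t →
    CarrierDissociated x d m →
    ((shallowPairs n m).filter fun p => ∃ ξ : Fin 2 → ℝ, NegWeight x d ξ ∧ IsRecord α β α' β' x d m ξ p).card
      ≤ 4 * (n.choose 2 + 1) * (5 * m - 1).choose m

/-- The chain of the line as I would cut it: `WeakRecordLemma` (✓ §4) → `MomentRecordCountG4` (S/M: letters bound ✓ above + arcs) →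
`MomentRecordLaw` (arithmetic: `4(C(n,2)+1)·C(5m−1,m) ≤ 2^{9m}(t+2)^2` under `n ≤ 2mt`).  Typed targets, not proved here. -/
def momentRecordCount_of_weak : Prop := WeakRecordLemma → MomentRecordCountG4

def momentRecordLaw_of_countG4 : Prop := MomentRecordCountG4 → MomentRecordLaw


/-! ## 4. PROOF of the weak record lemma over the landed Defs (K2-const, kernel-checked) -/

section WeakProof

open Polynomial

/- the letter pencil `γ_{j a} = α_{j a} + X·β_{j a} ∈ ℂ[X]` is the LANDED `MomentRecord.pencil` (✓ `…MomentRecordRungDefs`, 22:21Z),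
   same body as this file's rev 1–3 local def, which is therefore dropped. -/

theorem momentPoly_eq_pencil (α β : Fin m → Fin n → ℂ) (S : Fin n → ℕ) :
    momentPoly α β S = ∑ j, ∏ i, pencil α β j i ^ S i := rfl

theorem natDegree_pencil_le (α β : Fin m → Fin n → ℂ) (j : Fin m) (a : Fin n) :
    (pencil α β j a).natDegree ≤ 1 := by
  unfold pencil
  refine (natDegree_add_le _ _).trans (max_le (by simp) ?_)
  refine natDegree_mul_le.trans ?_
  simp

theorem natDegree_momentPoly_le (α β : Fin m → Fin n → ℂ) (S : Fin n → ℕ) :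
    (momentPoly α β S).natDegree ≤ size S := by
  rw [momentPoly_eq_pencil, size]
  refine natDegree_sum_le_of_forall_le _ _ (fun j _ => ?_)
  refine (natDegree_prod_le _ _).trans (Finset.sum_le_sum fun i _ => ?_)
  refine natDegree_pow_le.trans ?_
  calc S i * (pencil α β j i).natDegree ≤ S i * 1 := Nat.mul_le_mul_left _ (natDegree_pencil_le α β j i)
    _ = S i := mul_one _

theorem layer_eq_zero_of_size_lt (α β α' β' : Fin m → Fin n → ℂ) (k : ℕ) (S : Fin n → ℕ) (h : size S < k) :
    layer α β α' β' k S = 0 := by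
  unfold layer
  rw [coeff_sub, coeff_eq_zero_of_natDegree_lt ((natDegree_momentPoly_le α β S).trans_lt h),
    coeff_eq_zero_of_natDegree_lt ((natDegree_momentPoly_le α' β' S).trans_lt h), sub_zero]

theorem prod_pow_add_single (p : Fin n → ℂ[X]) (T : Fin n → ℕ) (a : Fin n) :
    ∏ i, p i ^ (T + Pi.single a 1 : Fin n → ℕ) i = p a * ∏ i, p i ^ T i := by
  simp only [Pi.add_apply, pow_add, Finset.prod_mul_distrib]
  rw [mul_comm]
  congr 1
  rw [Finset.prod_eq_single a]
  · simp
  · intro b _ hb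
    simp [hb]
  · intro h
    exact absurd (Finset.mem_univ a) h

theorem momentPoly_add_single (α β : Fin m → Fin n → ℂ) (T : Fin n → ℕ) (a : Fin n) :
    momentPoly α β (T + Pi.single a 1) = ∑ j, pencil α β j a * ∏ i, pencil α β j i ^ T i := by
  rw [momentPoly_eq_pencil]
  exact Finset.sum_congr rfl fun j _ => prod_pow_add_single (fun i => pencil α β j i) T a

theorem size_add_single (T : Fin n → ℕ) (b : Fin n) : size (T + Pi.single b 1) = size T + 1 := by
  simp [size, Finset.sum_add_distrib, Pi.single_apply]

theorem wtZ_ptZ_add_single (ξ : Fin 2 → ℝ) (x : Fin n → Expo) (d : Fin 2 → ℤ) (T : Fin n → ℕ) (b : Fin n) (k : ℕ) :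
    wtZ ξ (ptZ x d (T + Pi.single b 1) k) = wtZ ξ (ptZ x d T k) + wt ξ (x b) := by
  have h : ∀ c, ptZ x d (T + Pi.single b 1) k c = ptZ x d T k c + ((x b c : ℕ) : ℤ) := by
    intro c
    simp only [ptZ, Pi.add_apply, Nat.cast_add, add_mul, Finset.sum_add_distrib, Pi.single_apply, Nat.cast_ite,
      Nat.cast_one, Nat.cast_zero, ite_mul, one_mul, zero_mul, Finset.sum_ite_eq', Finset.mem_univ, if_true]
    ring
  simp only [wtZ, wt, h]
  push_cast
  ring

/-- (★) at the polynomial level: a CONSTANT relation among the pencils of carrier `a` and carriers `b ∈ Cs`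
propagates to the moment polynomials of `T + e_a`, `T`, `T + e_b`. -/
theorem momentPoly_rel (α β : Fin m → Fin n → ℂ) (a : Fin n) (Cs : Finset (Fin n)) (μ : ℂ) (ν : Fin n → ℂ)
    (hrel : ∀ j, pencil α β j a = C μ + ∑ b ∈ Cs, C (ν b) * pencil α β j b) (T : Fin n → ℕ) :
    momentPoly α β (T + Pi.single a 1) =
      C μ * momentPoly α β T + ∑ b ∈ Cs, C (ν b) * momentPoly α β (T + Pi.single b 1) := by
  simp_rw [momentPoly_add_single]
  rw [momentPoly_eq_pencil α β T, Finset.mul_sum]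
  simp_rw [Finset.mul_sum]
  rw [Finset.sum_comm, ← Finset.sum_add_distrib]
  refine Finset.sum_congr rfl fun j _ => ?_
  rw [hrel j, add_mul, Finset.sum_mul]
  congr 1
  exact Finset.sum_congr rfl fun b _ => by ring

/-- (★) at the layer level: SAME layer `k` on both sides, because the coefficients are constants. -/
theorem layer_rel (α β α' β' : Fin m → Fin n → ℂ) (a : Fin n) (Cs : Finset (Fin n)) (μ : ℂ) (ν : Fin n → ℂ)
    (hrel : ∀ j, pencil α β j a = C μ + ∑ b ∈ Cs, C (ν b) * pencil α β j b)
    (hrel' : ∀ j, pencil α' β' j a = C μ + ∑ b ∈ Cs, C (ν b) * pencil α' β' j b) (T : Fin n → ℕ) (k : ℕ) :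
    layer α β α' β' k (T + Pi.single a 1) =
      μ * layer α β α' β' k T + ∑ b ∈ Cs, ν b * layer α β α' β' k (T + Pi.single b 1) := by
  unfold layer
  rw [momentPoly_rel α β a Cs μ ν hrel T, momentPoly_rel α' β' a Cs μ ν hrel' T]
  simp only [coeff_sub, coeff_add, coeff_C_mul, finsetSum_coeff, mul_sub, Finset.sum_sub_distrib]
  ring

/-- **The weak record lemma holds, used-letter form** (K2 with constant coefficients; sign-free, layer-free, orientation-free). -/
theorem weakRecordLemmaUsed_holds : WeakRecordLemmaUsed := by
  intro m n m' α β α' β' x d ξ S k hneg hrec a hSa hmem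
  -- 1. the constant relation `π_a = μ𝟙 + Σ_{b ∈ supp l} l_b π_b`
  rw [Submodule.mem_span_insert] at hmem
  obtain ⟨μ, z, hz, hvec⟩ := hmem
  rw [Finsupp.mem_span_image_iff_linearCombination] at hz
  obtain ⟨l, hl, rfl⟩ := hz
  have hCs : ∀ b ∈ l.support, b ≠ a ∧ cost ξ x b ≤ cost ξ x a := by
    intro b hb
    have hsub : (↑l.support : Set (Fin n)) ⊆ {b : Fin n | b ≠ a ∧ cost ξ x b ≤ cost ξ x a} :=
      (Finsupp.mem_supported ℂ l).mp hl
    simpa using hsub (Finset.mem_coe.mpr hb)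
  have hvec' : pencilVec α β α' β' a =
      μ • oneVec m + ∑ b ∈ l.support, l b • pencilVec α β α' β' b := by
    rw [hvec, Finsupp.linearCombination_apply, Finsupp.sum]
  -- 2. row by row, as polynomial identities
  have hrow : ∀ j, pencil α β j a = C μ + ∑ b ∈ l.support, C (l b) * pencil α β j b := by
    intro j
    have h0 := congrFun (congrFun hvec' (Sum.inl j)) 0
    have h1 := congrFun (congrFun hvec' (Sum.inl j)) 1
    simp [pencilVec, oneVec] at h0 h1
    simp only [pencil, h0, h1, map_add, map_sum, map_mul]
    rw [Finset.mul_sum, add_assoc, ← Finset.sum_add_distrib]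
    congr 1
    exact Finset.sum_congr rfl fun b _ => by ring
  have hrow' : ∀ j, pencil α' β' j a = C μ + ∑ b ∈ l.support, C (l b) * pencil α' β' j b := by
    intro j
    have h0 := congrFun (congrFun hvec' (Sum.inr j)) 0
    have h1 := congrFun (congrFun hvec' (Sum.inr j)) 1
    simp [pencilVec, oneVec] at h0 h1
    simp only [pencil, h0, h1, map_add, map_sum, map_mul]
    rw [Finset.mul_sum, add_assoc, ← Finset.sum_add_distrib]
    congr 1
    exact Finset.sum_congr rfl fun b _ => by ring
  -- 3. `S = T + e_a`
  obtain ⟨T, rfl⟩ : ∃ T : Fin n → ℕ, S = T + Pi.single a 1 := by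
    refine ⟨Function.update S a (S a - 1), funext fun i => ?_⟩
    by_cases hi : i = a
    · subst hi
      simp [Nat.sub_add_cancel hSa]
    · simp [hi]
  -- the record, unpacked
  have hlive : (T + Pi.single a 1, k) ∈ live α β α' β' m' := hrec.1
  simp only [live, Set.mem_setOf_eq] at hlive
  obtain ⟨hsizeS, hkS, hlayerS⟩ := hlive
  rw [size_add_single] at hsizeS hkS
  have hbeat : ∀ q ∈ live α β α' β' m', q ≠ (T + Pi.single a 1, k) →
      wtZ ξ (ptZ x d q.1 q.2) < wtZ ξ (ptZ x d (T + Pi.single a 1) k) := hrec.2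
  have key := layer_rel α β α' β' a l.support μ (⇑l) hrow hrow' T k
  -- 4. the `𝟙`-term vanishes: either `x a` is a USED letter (negative weight ⇒ the competitor `(T, k)` is heavier ⇒ dead),
  --    or `a` and every cheaper-or-tied `b` are pure-shift carriers (`α = α' = 0` there) ⇒ `μ = 0` (resp. no rows at all when `m = 0`).
  have hμT : μ * layer α β α' β' k T = 0 := by
    by_cases hwa : wt ξ (x a) < 0
    · have hTa : layer α β α' β' k T = 0 := by
        by_contra hne
        have hkT : k ≤ size T := by
          by_contra hlt
          exact hne (layer_eq_zero_of_size_lt α β α' β' k T (not_le.mp hlt))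
        have hq : (T, k) ∈ live α β α' β' m' := by
          simp only [live, Set.mem_setOf_eq]
          exact ⟨by omega, hkT, hne⟩
        have hne' : (T, k) ≠ (T + Pi.single a 1, k) := by
          intro h
          have := congrFun (congrArg Prod.fst h) a
          simp at this
        have hlt := hbeat _ hq hne'
        dsimp only at hlt
        rw [wtZ_ptZ_add_single] at hlt
        linarith
      rw [hTa, mul_zero]
    · rcases Nat.eq_zero_or_pos m with hm | hm
      · subst hm
        simp [layer, momentPoly]
      · obtain ⟨j⟩ : Nonempty (Fin m) := ⟨⟨0, hm⟩⟩
        have hαa : α j a = 0 := by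
          by_contra h
          exact hwa (hneg a (Or.inl ⟨j, h⟩))
        have hαb : ∀ b ∈ l.support, l b * α j b = 0 := by
          intro b hb
          obtain ⟨hba, hcost⟩ := hCs b hb
          simp only [cost] at hcost
          have hwb : ¬ wt ξ (x b) < 0 := fun h => hwa (by linarith)
          have hb0 : α j b = 0 := by
            by_contra h
            exact hwb (hneg b (Or.inl ⟨j, h⟩))
          rw [hb0, mul_zero]
        have h0 := congrFun (congrFun hvec' (Sum.inl j)) 0
        simp [pencilVec, oneVec] at h0
        rw [hαa, Finset.sum_eq_zero hαb, add_zero] at h0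
        rw [← h0, zero_mul]
  -- 5. the competitors `(T + e_b, k)`, `b` cheaper-or-tied, are dead
  have hTb : ∀ b ∈ l.support, layer α β α' β' k (T + Pi.single b 1) = 0 := by
    intro b hb
    obtain ⟨hba, hcost⟩ := hCs b hb
    by_contra hne
    have hq : (T + Pi.single b 1, k) ∈ live α β α' β' m' := by
      simp only [live, Set.mem_setOf_eq, size_add_single]
      exact ⟨hsizeS, hkS, hne⟩
    have hne' : (T + Pi.single b 1, k) ≠ (T + Pi.single a 1, k) := by
      intro h
      have := congrFun (congrArg Prod.fst h) a
      simp [hba] at this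
    have hlt := hbeat _ hq hne'
    dsimp only at hlt
    rw [wtZ_ptZ_add_single, wtZ_ptZ_add_single] at hlt
    simp only [cost] at hcost
    linarith
  -- 6. hence `layer k S = 0`: contradiction with liveness of the record
  apply hlayerS
  rw [key, hμT, zero_add]
  exact Finset.sum_eq_zero fun b hb => by rw [hTb b hb, mul_zero]

/-- the all-carriers-negative form. -/
theorem weakRecordLemma_holds : WeakRecordLemma := weakRecordLemma_of_used weakRecordLemmaUsed_holds

/-- COROLLARY (unconditional): at most `4m` record letters per weight (both forms). -/
theorem recordLetterBoundUsed_holds : RecordLetterBoundUsed := recordLetterBoundUsed_of_weak weakRecordLemmaUsed_holds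

theorem recordLetterBound_holds : RecordLetterBound := recordLetterBound_of_weak weakRecordLemma_holds

end WeakProof

/-! ## 4. The CLASS COUNT (route I-const, last payment): cells of the weight plane × shallow multisets
   ⇒ THE LANDED (A) `MomentRecordLaw` and crit-8's (A∘) `MomentRecordLawUsed` (W4 rev 2/3), PROVED.

For REAL weights `ξ` (both signs of `ξ 1`, and `ξ 1 = 0`) the weak cost order on the carriers is decided by the CELL
`cellOf x ξ` = (signs of `ξ 1`, `ξ 0`; position of `ρ = ξ 0 / ξ 1` against the finite set of critical values `(Q₁ − P₁)/(P₀ − Q₀)`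
of carrier pairs) — at most `32 (n² + 1)` cells (the real/two-signed version of the integer template `DissocCount.stub_dissocCount`
of lead c3's engine).  Per cell, the record letters of ALL weights of the cell and ALL their records satisfy the greedy hypothesis
for ONE representative cost order (`cost_le_cost_iff_of_cellOf_eq`), so they are `≤ 4m` (`card_cellLetters_le`, from
`weakRecordLemmaUsed_holds` + `card_le_finrank_of_greedy`); a record `(S, k)` has `supp S ⊆` letters of its cell,
`Σ_{letters} S ≤ |S| ≤ m` and `k ≤ m`, whence `≤ (m+1) · Σ_{j ≤ m} #piAntidiag(letters, j) ≤ (m+1)² 2^{5m}` candidates per cell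
(stars and bars, `Finset.card_finsuppAntidiag_nat_eq_choose`).  Total `≤ 32 (n²+1) (m+1)² 2^{5m} ≤ 2^{17 m} (t+2)²` for
`1 ≤ m`, `n ≤ 2mt` (`m = 0`: one shallow pair).  The constants `(17, 2)` are lazy; `(9, 2)` is available with
`#cells ≤ 2·C(n,2)+3` and `C(5m−1, m)` (memo §1(3)). -/
section Count

/-- Critical value of an ordered pair of lattice points (a junk value when the abscissae agree — harmless, it only enlarges
the critical set). -/
def critVal (P Q : Expo) : ℝ := (((Q 1 : ℕ) : ℝ) - ((P 1 : ℕ) : ℝ)) / (((P 0 : ℕ) : ℝ) - ((Q 0 : ℕ) : ℝ))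

/-- The finite set of critical values of the carrier configuration `x` (`≤ n²` of them). -/
def critSet (x : Fin n → Expo) : Finset ℝ :=
  (Finset.univ : Finset (Fin n × Fin n)).image fun ab => critVal (x ab.1) (x ab.2)

/-- The CELL of a real weight: the signs of `ξ 1` and `ξ 0`, and the position of `ξ 0 / ξ 1` against the critical values. -/
def cellOf (x : Fin n → Expo) (ξ : Fin 2 → ℝ) : (Bool × Bool × Bool × Bool) × ℕ × Bool :=
  ((decide (0 < ξ 1), decide (ξ 1 < 0), decide (0 < ξ 0), decide (ξ 0 < 0)),
    ((critSet x).filter fun q => q < ξ 0 / ξ 1).card, decide (ξ 0 / ξ 1 ∈ critSet x))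

/-- A finite set containing every cell. -/
def cellSet (x : Fin n → Expo) : Finset ((Bool × Bool × Bool × Bool) × ℕ × Bool) :=
  Finset.univ ×ˢ (Finset.range ((critSet x).card + 1) ×ˢ Finset.univ)

theorem cellOf_mem_cellSet (x : Fin n → Expo) (ξ : Fin 2 → ℝ) : cellOf x ξ ∈ cellSet x := by
  simp only [cellSet, cellOf, Finset.mem_product, Finset.mem_univ, Finset.mem_range, true_and, and_true]
  exact Nat.lt_succ_of_le (Finset.card_filter_le _ _)

theorem card_critSet_le (x : Fin n → Expo) : (critSet x).card ≤ n ^ 2 := by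
  refine Finset.card_image_le.trans ?_
  rw [Finset.card_univ, Fintype.card_prod, Fintype.card_fin, sq]

theorem card_cellSet_le (x : Fin n → Expo) : (cellSet x).card ≤ 32 * (n ^ 2 + 1) := by
  have hQ := card_critSet_le x
  simp only [cellSet, Finset.card_product, Finset.card_univ, Fintype.card_prod, Fintype.card_bool,
    Finset.card_range]
  linarith

/-- `wt ξ P ≤ wt ξ Q` as a comparison of `ξ 0 · (P₀ − Q₀)` with `ξ 1 · (Q₁ − P₁)`. -/
theorem wt_le_wt_iff_sub (ξ : Fin 2 → ℝ) (P Q : Expo) :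
    wt ξ P ≤ wt ξ Q ↔ ξ 0 * (((P 0 : ℕ) : ℝ) - ((Q 0 : ℕ) : ℝ)) ≤ ξ 1 * (((Q 1 : ℕ) : ℝ) - ((P 1 : ℕ) : ℝ)) := by
  simp only [wt]
  constructor <;> intro h <;> linarith

/-- (`ℝ` copy of `DissocCount.lt_of_card_filter_lt_eq`.) -/
theorem lt_of_card_filter_lt_eq (Q : Finset ℝ) (ρ ρ' : ℝ)
    (h : (Q.filter (· < ρ)).card = (Q.filter (· < ρ')).card) {q : ℝ} (hq : q ∈ Q) (hlt : q < ρ) : q < ρ' := by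
  by_contra hn
  have hle : ρ' ≤ q := not_lt.mp hn
  have hsub : Q.filter (· < ρ') ⊆ Q.filter (· < ρ) := by
    intro y hy
    rw [Finset.mem_filter] at hy ⊢
    exact ⟨hy.1, (hy.2.trans_le hle).trans hlt⟩
  have hss : Q.filter (· < ρ') ⊂ Q.filter (· < ρ) :=
    (Finset.ssubset_iff_of_subset hsub).mpr
      ⟨q, Finset.mem_filter.mpr ⟨hq, hlt⟩, fun hx => hn (Finset.mem_filter.mp hx).2⟩
  exact absurd h (Finset.card_lt_card hss).ne'

/-- (`ℝ` copy of `DissocCount.eq_of_cell_eq`.) -/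
theorem eq_of_cell_eq (Q : Finset ℝ) (ρ ρ' : ℝ)
    (h : (Q.filter (· < ρ)).card = (Q.filter (· < ρ')).card) (hρ : ρ ∈ Q) (hρ' : ρ' ∈ Q) : ρ = ρ' := by
  rcases lt_trichotomy ρ ρ' with hlt | heq | hgt
  · exact absurd (lt_of_card_filter_lt_eq Q ρ' ρ h.symm hρ hlt) (lt_irrefl _)
  · exact heq
  · exact absurd (lt_of_card_filter_lt_eq Q ρ ρ' h hρ' hgt) (lt_irrefl _)

/-- (`ℝ` copy of `DissocCount.trichotomy_of_cell_eq`.) Two ratios with the same position `(#{q ∈ Q | q < ρ}, [ρ ∈ Q])`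
sit the same way relative to every `q ∈ Q`. -/
theorem trichotomy_of_cell_eq (Q : Finset ℝ) (ρ ρ' : ℝ)
    (h : (Q.filter (· < ρ)).card = (Q.filter (· < ρ')).card) (hβ : (ρ ∈ Q ↔ ρ' ∈ Q))
    {q : ℝ} (hq : q ∈ Q) : (q < ρ ↔ q < ρ') ∧ (q = ρ ↔ q = ρ') := by
  refine ⟨⟨lt_of_card_filter_lt_eq Q ρ ρ' h hq, lt_of_card_filter_lt_eq Q ρ' ρ h.symm hq⟩, ?_, ?_⟩
  · rintro rfl
    exact eq_of_cell_eq Q q ρ' h hq (hβ.mp hq)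
  · rintro rfl
    exact (eq_of_cell_eq Q ρ q h (hβ.mpr hq) hq).symm

/-- Position of `ρ` against `v / u` decides `ρ u ≤ v`. -/
theorem ratio_le_transfer (ρ ρ' u v : ℝ)
    (H : u ≠ 0 → ((v / u < ρ ↔ v / u < ρ') ∧ (v / u = ρ ↔ v / u = ρ'))) :
    (ρ * u ≤ v ↔ ρ' * u ≤ v) := by
  rcases lt_trichotomy 0 u with hpos | hzero | hneg
  · obtain ⟨h1, -⟩ := H hpos.ne'
    rw [← le_div_iff₀ hpos, ← le_div_iff₀ hpos, ← not_lt, ← not_lt]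
    exact not_congr h1
  · rw [← hzero, mul_zero, mul_zero]
  · obtain ⟨h1, h2⟩ := H hneg.ne
    rw [← div_le_iff_of_neg hneg, ← div_le_iff_of_neg hneg, le_iff_lt_or_eq, le_iff_lt_or_eq, h1, h2]

/-- Position of `ρ` against `v / u` decides `v ≤ ρ u`. -/
theorem ratio_ge_transfer (ρ ρ' u v : ℝ)
    (H : u ≠ 0 → ((v / u < ρ ↔ v / u < ρ') ∧ (v / u = ρ ↔ v / u = ρ'))) :
    (v ≤ ρ * u ↔ v ≤ ρ' * u) := by
  rcases lt_trichotomy 0 u with hpos | hzero | hneg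
  · obtain ⟨h1, h2⟩ := H hpos.ne'
    rw [← div_le_iff₀ hpos, ← div_le_iff₀ hpos, le_iff_lt_or_eq, le_iff_lt_or_eq, h1, h2]
  · rw [← hzero, mul_zero, mul_zero]
  · obtain ⟨h1, -⟩ := H hneg.ne
    rw [← le_div_iff_of_neg hneg, ← le_div_iff_of_neg hneg, ← not_lt, ← not_lt]
    exact not_congr h1

/-- **Same cell ⇒ same weak order of the carrier weights** (real weights, all signs). -/
theorem wt_le_wt_iff_of_cellOf_eq (x : Fin n → Expo) {ξ ξ' : Fin 2 → ℝ} (h : cellOf x ξ = cellOf x ξ') (a b : Fin n) :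
    (wt ξ (x a) ≤ wt ξ (x b) ↔ wt ξ' (x a) ≤ wt ξ' (x b)) := by
  simp only [cellOf, Prod.mk.injEq, decide_eq_decide] at h
  obtain ⟨⟨h1p, h1n, h0p, h0n⟩, hcard, hmem⟩ := h
  rw [wt_le_wt_iff_sub ξ, wt_le_wt_iff_sub ξ']
  set u : ℝ := ((x a 0 : ℕ) : ℝ) - ((x b 0 : ℕ) : ℝ) with hu
  set v : ℝ := ((x b 1 : ℕ) : ℝ) - ((x a 1 : ℕ) : ℝ) with hv
  have hq : critVal (x a) (x b) ∈ critSet x := Finset.mem_image.mpr ⟨(a, b), Finset.mem_univ _, rfl⟩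
  have hcrit : critVal (x a) (x b) = v / u := rfl
  obtain ⟨hlt, heq⟩ := trichotomy_of_cell_eq (critSet x) (ξ 0 / ξ 1) (ξ' 0 / ξ' 1) hcard hmem hq
  rw [hcrit] at hlt heq
  rcases lt_trichotomy 0 (ξ 1) with h1 | h1 | h1
  · -- `ξ 1 > 0`, hence `ξ' 1 > 0`: compare `ρ u ≤ v`
    have key : ∀ η : Fin 2 → ℝ, 0 < η 1 → (η 0 * u ≤ η 1 * v ↔ η 0 / η 1 * u ≤ v) := fun η hη => by
      rw [div_mul_eq_mul_div, div_le_iff₀ hη, mul_comm (η 1) v]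
    rw [key ξ h1, key ξ' (h1p.mp h1)]
    exact ratio_le_transfer _ _ u v fun _ => ⟨hlt, heq⟩
  · -- `ξ 1 = 0`, hence `ξ' 1 = 0`: the sign of `ξ 0` decides
    have hξ1 : ξ 1 = 0 := h1.symm
    have hξ1' : ξ' 1 = 0 := by
      rcases lt_trichotomy (ξ' 1) 0 with hh | hh | hh
      · exact absurd (h1n.mpr hh) (by rw [hξ1]; exact lt_irrefl 0)
      · exact hh
      · exact absurd (h1p.mpr hh) (by rw [hξ1]; exact lt_irrefl 0)
    rw [hξ1, hξ1', zero_mul]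
    have epos : ∀ c : ℝ, 0 < c → (c * u ≤ 0 ↔ u ≤ 0) := fun c hc =>
      ⟨fun h => not_lt.mp fun hu' => (not_lt.mpr h) (mul_pos hc hu'),
        fun h => by simpa using mul_le_mul_of_nonneg_left h hc.le⟩
    have eneg : ∀ c : ℝ, c < 0 → (c * u ≤ 0 ↔ 0 ≤ u) := fun c hc =>
      ⟨fun h => not_lt.mp fun hu' => (not_lt.mpr h) (mul_pos_of_neg_of_neg hc hu'),
        fun h => by simpa using mul_le_mul_of_nonneg_right hc.le h⟩
    rcases lt_trichotomy 0 (ξ 0) with h0 | h0 | h0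
    · rw [epos _ h0, epos _ (h0p.mp h0)]
    · have hξ0 : ξ 0 = 0 := h0.symm
      have hξ0' : ξ' 0 = 0 := by
        rcases lt_trichotomy (ξ' 0) 0 with hh | hh | hh
        · exact absurd (h0n.mpr hh) (by rw [hξ0]; exact lt_irrefl 0)
        · exact hh
        · exact absurd (h0p.mpr hh) (by rw [hξ0]; exact lt_irrefl 0)
      rw [hξ0, hξ0']
    · rw [eneg _ h0, eneg _ (h0n.mp h0)]
  · -- `ξ 1 < 0`, hence `ξ' 1 < 0`: compare `v ≤ ρ u`
    have key : ∀ η : Fin 2 → ℝ, η 1 < 0 → (η 0 * u ≤ η 1 * v ↔ v ≤ η 0 / η 1 * u) := fun η hη => by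
      rw [div_mul_eq_mul_div, le_div_iff_of_neg hη, mul_comm (η 1) v]
    rw [key ξ h1, key ξ' (h1n.mp h1)]
    exact ratio_ge_transfer _ _ u v fun _ => ⟨hlt, heq⟩

theorem cost_le_cost_iff_of_cellOf_eq (x : Fin n → Expo) {ξ ξ' : Fin 2 → ℝ} (h : cellOf x ξ = cellOf x ξ')
    (a b : Fin n) : (cost ξ x b ≤ cost ξ x a ↔ cost ξ' x b ≤ cost ξ' x a) := by
  simp only [cost, neg_le_neg_iff]
  exact wt_le_wt_iff_of_cellOf_eq x h a b

/-- Used base letters are negative: the first clause of crit-8's `NegWeightUsed` (W4 rev 2/3) — all the count needs. -/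
def NegUsedBase (α α' : Fin m → Fin n → ℂ) (x : Fin n → Expo) (ξ : Fin 2 → ℝ) : Prop :=
  ∀ i, ((∃ j, α j i ≠ 0) ∨ ∃ j, α' j i ≠ 0) → wt ξ (x i) < 0

/-- The record letters of a CELL: carriers occurring in some record of some admissible weight of the cell. -/
def cellLetters (α β α' β' : Fin m → Fin n → ℂ) (x : Fin n → Expo) (d : Fin 2 → ℤ) (m' : ℕ)
    (κ : (Bool × Bool × Bool × Bool) × ℕ × Bool) : Finset (Fin n) :=
  Finset.univ.filter fun a => ∃ ξ : Fin 2 → ℝ, NegUsedBase α α' x ξ ∧ cellOf x ξ = κ ∧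
    ∃ (S : Fin n → ℕ) (k : ℕ), IsRecord α β α' β' x d m' ξ (S, k) ∧ 0 < S a

/-- **≤ 4m record letters PER CELL** (uniformly over all weights of the cell and all shallowness-`m'` records). -/
theorem card_cellLetters_le (α β α' β' : Fin m → Fin n → ℂ) (x : Fin n → Expo) (d : Fin 2 → ℤ) (m' : ℕ)
    (κ : (Bool × Bool × Bool × Bool) × ℕ × Bool) : (cellLetters α β α' β' x d m' κ).card ≤ 4 * m := by
  rcases (cellLetters α β α' β' x d m' κ).eq_empty_or_nonempty with he | ⟨a₀, ha₀⟩
  · rw [he, Finset.card_empty]; exact Nat.zero_le _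
  · simp only [cellLetters, Finset.mem_filter, Finset.mem_univ, true_and] at ha₀
    obtain ⟨ξ₀, -, hξ₀, -⟩ := ha₀
    have h := card_le_finrank_of_greedy (k := ℂ) (cost ξ₀ x) (pencilVec α β α' β') (oneVec m)
      (cellLetters α β α' β' x d m' κ) ?_
    · simpa [finrank_pencilSpace] using h
    · intro a ha
      simp only [cellLetters, Finset.mem_filter, Finset.mem_univ, true_and] at ha
      obtain ⟨ξ, hneg, hξ, S, k, hrec, hSa⟩ := ha
      have hset : {b : Fin n | b ≠ a ∧ cost ξ₀ x b ≤ cost ξ₀ x a} = {b : Fin n | b ≠ a ∧ cost ξ x b ≤ cost ξ x a} := by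
        ext b
        simp only [Set.mem_setOf_eq, cost_le_cost_iff_of_cellOf_eq x (hξ₀.trans hξ.symm) a b]
      rw [hset]
      exact weakRecordLemmaUsed_holds m n m' α β α' β' x d ξ S k hneg hrec a hSa

/-- Candidate pairs over a letter set `L`: `S` with `Σ_{L} S = j ≤ m'`, `supp S ⊆ L`, and `k ≤ m'`. -/
def candidates (L : Finset (Fin n)) (m' : ℕ) : Finset ((Fin n → ℕ) × ℕ) :=
  ((Finset.range (m' + 1)).biUnion fun j => Finset.piAntidiag L j) ×ˢ Finset.range (m' + 1)

theorem mem_candidates {L : Finset (Fin n)} {m' : ℕ} {S : Fin n → ℕ} {k : ℕ} (hS : size S ≤ m') (hk : k ≤ m')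
    (hL : ∀ a, S a ≠ 0 → a ∈ L) : (S, k) ∈ candidates L m' := by
  rw [candidates, Finset.mem_product, Finset.mem_biUnion]
  refine ⟨⟨L.sum S, Finset.mem_range.mpr (Nat.lt_succ_of_le ?_), Finset.mem_piAntidiag.mpr ⟨rfl, hL⟩⟩,
    Finset.mem_range.mpr (Nat.lt_succ_of_le hk)⟩
  calc L.sum S ≤ ∑ i, S i := Finset.sum_le_sum_of_subset (Finset.subset_univ L)
    _ ≤ m' := hS

theorem card_piAntidiag_le (L : Finset (Fin n)) (j : ℕ) : (Finset.piAntidiag L j).card ≤ 2 ^ (L.card + j) := by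
  have h : (L.finsuppAntidiag j).card = (Finset.piAntidiag L j).card := by
    rw [Finset.finsuppAntidiag, Finset.card_map, Finset.card_attach]
  rw [← h, Finset.card_finsuppAntidiag_nat_eq_choose]
  exact (Nat.choose_le_two_pow _ _).trans (Nat.pow_le_pow_right (by norm_num) (by omega))

theorem card_candidates_le (L : Finset (Fin n)) (m' : ℕ) (hL : L.card ≤ 4 * m') :
    (candidates L m').card ≤ (m' + 1) * 2 ^ (5 * m') * (m' + 1) := by
  rw [candidates, Finset.card_product, Finset.card_range]
  refine Nat.mul_le_mul_right _ ?_
  calc _ ≤ ∑ j ∈ Finset.range (m' + 1), (Finset.piAntidiag L j).card := Finset.card_biUnion_le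
    _ ≤ ∑ _j ∈ Finset.range (m' + 1), 2 ^ (5 * m') := Finset.sum_le_sum fun j hj => ?_
    _ = (m' + 1) * 2 ^ (5 * m') := by rw [Finset.sum_const, Finset.card_range, smul_eq_mul]
  have hj := Finset.mem_range.mp hj
  exact (card_piAntidiag_le L j).trans (Nat.pow_le_pow_right (by norm_num) (by omega))

/-- **THE CLASS COUNT.** Records over weights negative on the used base letters number
`≤ 32 (n² + 1) · (m+1)² 2^{5m}` — no sparsity, no dissociation, no orientation hypothesis. -/
theorem momentRecordCount (m n : ℕ) (α β α' β' : Fin m → Fin n → ℂ) (x : Fin n → Expo) (d : Fin 2 → ℤ) :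
    ((shallowPairs n m).filter fun p => ∃ ξ : Fin 2 → ℝ, NegUsedBase α α' x ξ ∧ IsRecord α β α' β' x d m ξ p).card
      ≤ 32 * (n ^ 2 + 1) * ((m + 1) * 2 ^ (5 * m) * (m + 1)) := by
  calc _ ≤ ((cellSet x).biUnion fun κ => candidates (cellLetters α β α' β' x d m κ) m).card :=
        Finset.card_le_card ?_
    _ ≤ ∑ κ ∈ cellSet x, (candidates (cellLetters α β α' β' x d m κ) m).card := Finset.card_biUnion_le
    _ ≤ ∑ _κ ∈ cellSet x, (m + 1) * 2 ^ (5 * m) * (m + 1) :=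
        Finset.sum_le_sum fun κ _ => card_candidates_le _ _ (card_cellLetters_le α β α' β' x d m κ)
    _ = (cellSet x).card * ((m + 1) * 2 ^ (5 * m) * (m + 1)) := by rw [Finset.sum_const, smul_eq_mul]
    _ ≤ 32 * (n ^ 2 + 1) * ((m + 1) * 2 ^ (5 * m) * (m + 1)) := Nat.mul_le_mul_right _ (card_cellSet_le x)
  rintro ⟨S, k⟩ hp
  rw [Finset.mem_filter] at hp
  obtain ⟨-, ξ, hneg, hrec⟩ := hp
  rw [Finset.mem_biUnion]
  refine ⟨cellOf x ξ, cellOf_mem_cellSet x ξ, ?_⟩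
  have hlive := hrec.1
  simp only [live, Set.mem_setOf_eq] at hlive
  obtain ⟨hsize, hk, -⟩ := hlive
  refine mem_candidates hsize (hk.trans hsize) fun a ha => ?_
  simp only [cellLetters, Finset.mem_filter, Finset.mem_univ, true_and]
  exact ⟨ξ, hneg, rfl, S, k, hrec, Nat.pos_of_ne_zero ha⟩

/-- Lazy arithmetic: `32 (n²+1) (m+1)² 2^{5m} ≤ 2^{17m} (t+2)²` for `1 ≤ m`, `n ≤ 2mt`. -/
theorem arith_bound (m n t : ℕ) (hm : 1 ≤ m) (hn : n ≤ 2 * m * t) :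
    32 * (n ^ 2 + 1) * ((m + 1) * 2 ^ (5 * m) * (m + 1)) ≤ 2 ^ (17 * m) * (t + 2) ^ 2 := by
  obtain ⟨X, hX⟩ : ∃ X : ℕ, X = 2 ^ m := ⟨_, rfl⟩
  have hmX : m + 1 ≤ X := hX ▸ Nat.lt_two_pow_self
  have hX2 : 2 ≤ X := by
    rw [hX]
    calc (2 : ℕ) = 2 ^ 1 := (pow_one 2).symm
      _ ≤ 2 ^ m := Nat.pow_le_pow_right (by norm_num) hm
  have hX0 : 0 < X := by omega
  have hn' : n ≤ 2 * X * (t + 2) := by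
    calc n ≤ 2 * m * t := hn
      _ ≤ 2 * X * (t + 2) := Nat.mul_le_mul (Nat.mul_le_mul_left 2 (by omega)) (by omega)
  have h5 : 2 ^ (5 * m) = X ^ 5 := by rw [hX, ← pow_mul, mul_comm]
  have h17 : 2 ^ (17 * m) = X ^ 17 := by rw [hX, ← pow_mul, mul_comm]
  rw [h5, h17]
  have hA : n ^ 2 + 1 ≤ (2 * X * (t + 2)) ^ 2 + X ^ 2 * (t + 2) ^ 2 :=
    Nat.add_le_add (Nat.pow_le_pow_left hn' 2) (mul_pos (pow_pos hX0 2) (pow_pos (by omega) 2))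
  have hB : (m + 1) * X ^ 5 * (m + 1) ≤ X * X ^ 5 * X := Nat.mul_le_mul (Nat.mul_le_mul_right _ hmX) hmX
  have h160 : 160 ≤ X ^ 8 :=
    calc 160 ≤ 2 ^ 8 := by norm_num
      _ ≤ X ^ 8 := Nat.pow_le_pow_left hX2 8
  calc 32 * (n ^ 2 + 1) * ((m + 1) * X ^ 5 * (m + 1))
      ≤ 32 * ((2 * X * (t + 2)) ^ 2 + X ^ 2 * (t + 2) ^ 2) * (X * X ^ 5 * X) :=
        Nat.mul_le_mul (Nat.mul_le_mul_left _ hA) hB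
    _ = 160 * (X ^ 9 * (t + 2) ^ 2) := by ring
    _ ≤ X ^ 8 * (X ^ 9 * (t + 2) ^ 2) := Nat.mul_le_mul_right _ h160
    _ = X ^ 17 * (t + 2) ^ 2 := by ring

/-- The law-shaped bound behind (A) and (A∘). -/
theorem momentRecordCount_law (m n t : ℕ) (α β α' β' : Fin m → Fin n → ℂ) (x : Fin n → Expo) (d : Fin 2 → ℤ)
    (hn : n ≤ 2 * m * t) :
    ((shallowPairs n m).filter fun p => ∃ ξ : Fin 2 → ℝ, NegUsedBase α α' x ξ ∧ IsRecord α β α' β' x d m ξ p).card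
      ≤ 2 ^ (17 * m) * (t + 2) ^ 2 := by
  rcases Nat.eq_zero_or_pos m with rfl | hm
  · have hn0 : n = 0 := by omega
    subst hn0
    calc _ ≤ (shallowPairs 0 0).card := Finset.card_filter_le _ _
      _ = 1 := by simp [shallowPairs]
      _ ≤ 2 ^ (17 * 0) * (t + 2) ^ 2 := Nat.one_le_iff_ne_zero.mpr (by positivity)
  · exact (momentRecordCount m n α β α' β' x d).trans (arith_bound m n t hm hn)

/-- **(A∘) = THE LANDED RUNG STATEMENT OF RECORD `MomentRecordLawUsed` (✓ `…MomentRecordRungDefs`, crit-8 W4) PROVED**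
(with `(a, b) = (17, 2)`; only the first clause of `NegWeightUsed` is used). -/
theorem momentRecordLawUsed_holds : MomentRecordLawUsed := by
  refine ⟨17, 2, fun m n t α β α' β' x d _ hn => ?_⟩
  refine (Finset.card_le_card ?_).trans (momentRecordCount_law m n t α β α' β' x d hn)
  intro p hp
  rw [Finset.mem_filter] at hp ⊢
  obtain ⟨hp, ξ, hξ, hrec⟩ := hp
  exact ⟨hp, ξ, fun i h => (hξ i).1 h, hrec⟩

/-- **THE LANDED (A) `MomentRecordLaw` PROVED** (with `(a, b) = (17, 2)`; its hypotheses `TermSparse`, `CarrierDissociated` are not used). -/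
theorem momentRecordLaw_holds : MomentRecordLaw := by
  refine ⟨17, 2, fun m n t α β α' β' x d _ _ _ hn _ => ?_⟩
  refine (Finset.card_le_card ?_).trans (momentRecordCount_law m n t α β α' β' x d hn)
  intro p hp
  rw [Finset.mem_filter] at hp ⊢
  obtain ⟨hp, ξ, hξ, hrec⟩ := hp
  exact ⟨hp, ξ, fun i _ => (hξ i).1, hrec⟩

/-- the typed glue target `momentRecordLaw_of_lawUsed` of the RungDefs, discharged (trivially, given the above). -/
theorem momentRecordLaw_of_lawUsed_holds : momentRecordLaw_of_lawUsed := fun _ => momentRecordLaw_holds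

end Count


/-! ## Audit: the landed statements, by their tree names, are inhabited by this file's theorems. -/
example : Summit.ValiantsHypothesis.ValiantsHypothesis.Theorems.NewtonUnitEquations.TwoProducts.MomentRecord.MomentRecordLaw :=
  momentRecordLaw_holds
example : Summit.ValiantsHypothesis.ValiantsHypothesis.Theorems.NewtonUnitEquations.TwoProducts.MomentRecord.MomentRecordLawUsed :=
  momentRecordLawUsed_holds
example : Summit.ValiantsHypothesis.ValiantsHypothesis.Theorems.NewtonUnitEquations.TwoProducts.MomentRecord.momentRecordLaw_of_lawUsed :=
  momentRecordLaw_of_lawUsed_holds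

end ValIdea37g4

end

#print axioms ValIdea37g4.momentRecordLaw_holds
#print axioms ValIdea37g4.momentRecordLawUsed_holds
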